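import Literature.MathematicalPhysics.QuantumLattice.SectorPartitionOfUnity
import HarnessLib

/-!
# The sector partition of unity on the circle (Benfatto–Giuliani–Mastropietro 2006, (2.45))

Topic `Literature/MathematicalPhysics/QuantumLattice`; continues `SectorPartitionOfUnity.lean`,
which builds the LINE family `ζ_{n,j}(θ) = Z₁(θ/w_n - j - ½)`, `j ∈ ℤ` (`sectorWeight`), with
plateau, support, `Σ_{j ∈ ℤ} ζ_{n,j} = 1`, the covariance `ζ_{n,j+N}(θ + 2π) = ζ_{n,j}(θ)`
(`N = 2^{n+1}`) and the scale-covariant derivative bounds `|ζ^{(m)}| ≤ C_m w_n^{-m}`.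

BGM 2006 (2.45) asks for functions ON THE CIRCLE `𝕋¹`, indexed by `ω ∈ O_h` (`N` indices), with
`Σ_{ω ∈ O_h} ζ_{h,ω}(θ) = 1 ∀ θ ∈ 𝕋¹` — this is what is composed with the polar angle of a
momentum in the sector cutoffs `F_{h,ω}(k') = f̃_h(k') ζ_{h,ω}(θ')` of (2.46). This file PROVES that
the `2π`-PERIODISATION in the index,
`ζ̃_{n,ω}(θ) = Σ_{k ∈ ℤ} ζ_{n,ω+kN}(θ)` (`sectorWeightCirc`, a locally finite sum: at most two
consecutive `k` contribute near any point, `sectorWeightCirc_eventuallyEq`), has all the printed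
properties:

* `2π`-periodic in `θ` (`sectorWeightCirc_add_two_pi`) and `N`-periodic in `ω`
  (`sectorWeightCirc_add_sectorCount`), smooth (`contDiff_sectorWeightCirc`), `[0,1]`-valued;
* **plateau**: `|θ - θ_{n,ω} - 2πk| ≤ w_n/4` for some `k` ⟹ `ζ̃_{n,ω}(θ) = 1`; **support**:
  `|θ - θ_{n,ω} - 2πk| ≥ 3w_n/4` for all `k` ⟹ `ζ̃_{n,ω}(θ) = 0` (`θ_{n,ω} = (ω+½)w_n`), i.e. the two
  properties of (2.45) in terms of the distance on the circle;
* **partition of unity on the circle**: `Σ_{ω<N} ζ̃_{n,ω}(θ) = 1` for EVERY real `θ`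
  (`sum_sectorWeightCirc_eq_one`);
* **derivative bounds**: `|ζ̃_{n,ω}^{(m)}(θ)| ≤ 2C_m w_n^{-m}` (`abs_iteratedDeriv_sectorWeightCirc_le`).

Everything is PROVED; the only definition (`sectorWeightCirc`) has a body.

## Sources

* G. Benfatto, A. Giuliani, V. Mastropietro, Ann. Henri Poincaré 7 (2006) 809–898, §2.5
  (2.45)–(2.46) and Lemma 2.2 (arXiv:cond-mat/0507686 pp. 10–11). [BenfattoGiulianiMastropietro2006]
* G. Benfatto, A. Giuliani, V. Mastropietro, Ann. Henri Poincaré 4 (2003) 137–193, (3.44a), §7.2.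
  [BenfattoGiulianiMastropietro2003]
-/

noncomputable section

open Real Set Filter Metric
open scoped Topology

namespace Literature.MathematicalPhysics.QuantumLattice

/-- `w_n = π/2^n ≤ π`. [folklore] -/
theorem sectorWidth_le_pi (n : ℕ) : sectorWidth n ≤ π := by
  rw [sectorWidth]
  exact div_le_self pi_pos.le (one_le_pow₀ (by norm_num))

/-- `0 < N = 2^{n+1}`. [folklore] -/
theorem sectorCount_pos (n : ℕ) : 0 < sectorCount n := by
  rw [sectorCount]; positivity

/-- **The sector weight on the circle**: `ζ̃_{n,ω}(θ) = Σ_{k ∈ ℤ} ζ_{n,ω+kN}(θ)`, `N = 2^{n+1}`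
(the translates `ζ_{n,ω+kN}` are centred at `θ_{n,ω} + 2πk`). [cite: BenfattoGiulianiMastropietro2006, §2.5 (2.45)] -/
def sectorWeightCirc (n : ℕ) (ω : ℤ) (θ : ℝ) : ℝ := ∑' k : ℤ, sectorWeight n (ω + k * sectorCount n) θ

/-- The centre of the `k`-th translate: `(ω + kN + ½) w_n = (ω + ½) w_n + 2πk`. [folklore] -/
theorem sectorTranslate_center (n : ℕ) (ω k : ℤ) :
    (((ω + k * sectorCount n : ℤ) : ℝ) + 1 / 2) * sectorWidth n = ((ω : ℝ) + 1 / 2) * sectorWidth n + 2 * π * k := by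
  have hN := sectorCount_mul_sectorWidth n
  push_cast
  linear_combination (k : ℝ) * hN

/-- Far translates vanish: if `|θ - θ_{n,ω} - 2πk| ≥ 3w_n/4` then the `k`-th term is `0`. [folklore] -/
theorem sectorWeight_translate_eq_zero {n : ℕ} {ω k : ℤ} {θ : ℝ}
    (h : 3 * sectorWidth n / 4 ≤ |θ - ((ω : ℝ) + 1 / 2) * sectorWidth n - 2 * π * k|) :
    sectorWeight n (ω + k * sectorCount n) θ = 0 := by
  apply sectorWeight_eq_zero
  rw [sectorTranslate_center]
  rwa [← sub_sub]

/-- Local finiteness: with `t = (θ₀ - θ_{n,ω})/(2π)`, for `|θ - θ₀| < π/2` only `k ∈ {⌊t⌋, ⌊t⌋+1}`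
can contribute. [folklore] -/
theorem sectorWeight_translate_eq_zero_of_notMem {n : ℕ} {ω : ℤ} {θ₀ θ : ℝ} (hθ : |θ - θ₀| < π / 2) {k : ℤ}
    (hk : k ∉ ({⌊(θ₀ - ((ω : ℝ) + 1 / 2) * sectorWidth n) / (2 * π)⌋,
      ⌊(θ₀ - ((ω : ℝ) + 1 / 2) * sectorWidth n) / (2 * π)⌋ + 1} : Finset ℤ)) :
    sectorWeight n (ω + k * sectorCount n) θ = 0 := by
  have hw := sectorWidth_pos n
  have hwπ := sectorWidth_le_pi n
  set c := ((ω : ℝ) + 1 / 2) * sectorWidth n with hc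
  set t := (θ₀ - c) / (2 * π) with ht
  apply sectorWeight_translate_eq_zero
  by_contra hlt
  push Not at hlt
  -- then `|t - k| < 5/8`, forcing `k ∈ {⌊t⌋, ⌊t⌋ + 1}`
  have h1 : |θ₀ - c - 2 * π * k| < 5 * π / 4 := by
    have := abs_sub_le (θ₀ - c - 2 * π * k) (θ - c - 2 * π * k) 0
    simp only [sub_zero] at this
    have h2 : |θ₀ - c - 2 * π * k - (θ - c - 2 * π * k)| = |θ - θ₀| := by
      rw [show θ₀ - c - 2 * π * k - (θ - c - 2 * π * k) = -(θ - θ₀) by ring, abs_neg]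
    linarith [pi_pos]
  have h2 : θ₀ - c = 2 * π * t := by rw [ht]; field_simp
  rw [h2, ← mul_sub, abs_mul, abs_of_pos two_pi_pos] at h1
  have h3 : |t - k| < 5 / 8 := by nlinarith [pi_pos, abs_nonneg (t - k)]
  rw [abs_lt] at h3
  have hfl := Int.floor_le t
  have hlt' := Int.lt_floor_add_one t
  simp only [Finset.mem_insert, Finset.mem_singleton, not_or] at hk
  rcases lt_trichotomy k ⌊t⌋ with hlt'' | heq | hgt
  · have : (k : ℝ) + 1 ≤ ⌊t⌋ := by exact_mod_cast hlt''
    linarith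
  · exact hk.1 heq
  · have h4 : ⌊t⌋ + 2 ≤ k := by
      have : ⌊t⌋ + 1 < k := lt_of_le_of_ne (by omega) (Ne.symm hk.2)
      omega
    have : ((⌊t⌋ : ℤ) : ℝ) + 2 ≤ k := by exact_mod_cast h4
    linarith

/-- The family of translates is summable (finite support). [folklore] -/
theorem summable_sectorWeight_translate (n : ℕ) (ω : ℤ) (θ : ℝ) :
    Summable fun k : ℤ => sectorWeight n (ω + k * sectorCount n) θ :=
  summable_of_ne_finset_zero fun k hk =>
    sectorWeight_translate_eq_zero_of_notMem (θ₀ := θ) (by simpa using div_pos pi_pos two_pos) hk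

/-- **Local finiteness**: near `θ₀`, `ζ̃_{n,ω}` is the sum of the two translates `k ∈ {⌊t⌋, ⌊t⌋+1}`. [folklore] -/
theorem sectorWeightCirc_eventuallyEq (n : ℕ) (ω : ℤ) (θ₀ : ℝ) :
    sectorWeightCirc n ω =ᶠ[𝓝 θ₀] fun θ =>
      ∑ k ∈ ({⌊(θ₀ - ((ω : ℝ) + 1 / 2) * sectorWidth n) / (2 * π)⌋,
        ⌊(θ₀ - ((ω : ℝ) + 1 / 2) * sectorWidth n) / (2 * π)⌋ + 1} : Finset ℤ),
        sectorWeight n (ω + k * sectorCount n) θ := by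
  have hball : ball θ₀ (π / 2) ∈ 𝓝 θ₀ := ball_mem_nhds θ₀ (div_pos pi_pos two_pos)
  filter_upwards [hball] with θ hθ
  rw [mem_ball, Real.dist_eq] at hθ
  exact tsum_eq_sum fun k hk => sectorWeight_translate_eq_zero_of_notMem hθ hk

/-- **`ζ̃_{n,ω}` is smooth.** [cite: BenfattoGiulianiMastropietro2006, §2.5 (2.45)] -/
theorem contDiff_sectorWeightCirc (n : ℕ) (ω : ℤ) {m : ℕ∞} : ContDiff ℝ m (sectorWeightCirc n ω) := by
  refine contDiff_iff_contDiffAt.2 fun θ₀ => ?_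
  refine ContDiffAt.congr_of_eventuallyEq ?_ (sectorWeightCirc_eventuallyEq n ω θ₀)
  exact ContDiffAt.sum fun k _ => (contDiff_sectorWeight n _).contDiffAt

/-- **`2π`-periodicity in `θ`.** [cite: BenfattoGiulianiMastropietro2006, §2.5 (2.45)] -/
theorem sectorWeightCirc_add_two_pi (n : ℕ) (ω : ℤ) (θ : ℝ) :
    sectorWeightCirc n ω (θ + 2 * π) = sectorWeightCirc n ω θ := by
  unfold sectorWeightCirc
  rw [← (Equiv.addRight (1 : ℤ)).tsum_eq (fun k : ℤ => sectorWeight n (ω + k * sectorCount n) (θ + 2 * π))]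
  refine tsum_congr fun k => ?_
  simp only [Equiv.coe_addRight]
  rw [show ω + (k + 1) * (sectorCount n : ℤ) = (ω + k * sectorCount n) + sectorCount n by ring,
    sectorWeight_add_sectorCount_add_two_pi]

/-- `ζ̃_{n,ω}` is `2π`-periodic. [folklore] -/
theorem periodic_sectorWeightCirc (n : ℕ) (ω : ℤ) : Function.Periodic (sectorWeightCirc n ω) (2 * π) :=
  fun θ => sectorWeightCirc_add_two_pi n ω θ

/-- **`N`-periodicity in the index**: `ζ̃_{n,ω+N} = ζ̃_{n,ω}` (so the family is indexed by
`ω mod N`, i.e. by `O_h`). [cite: BenfattoGiulianiMastropietro2006, §2.5 (2.45)] -/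
theorem sectorWeightCirc_add_sectorCount (n : ℕ) (ω : ℤ) (θ : ℝ) :
    sectorWeightCirc n (ω + sectorCount n) θ = sectorWeightCirc n ω θ := by
  unfold sectorWeightCirc
  conv_rhs => rw [← (Equiv.addRight (1 : ℤ)).tsum_eq (fun k : ℤ => sectorWeight n (ω + k * sectorCount n) θ)]
  refine tsum_congr fun k => ?_
  simp only [Equiv.coe_addRight]
  congr 1
  ring

/-- `0 ≤ ζ̃_{n,ω}`. [folklore] -/
theorem sectorWeightCirc_nonneg (n : ℕ) (ω : ℤ) (θ : ℝ) : 0 ≤ sectorWeightCirc n ω θ :=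
  tsum_nonneg fun _ => (sectorWeight_mem_Icc n _ θ).1

/-- `ζ̃_{n,ω} ≤ 1` (it is a sub-sum of the full partition of unity `Σ_j ζ_{n,j} = 1`). [folklore] -/
theorem sectorWeightCirc_le_one (n : ℕ) (ω : ℤ) (θ : ℝ) : sectorWeightCirc n ω θ ≤ 1 := by
  have hN : sectorCount n ≠ 0 := (sectorCount_pos n).ne'
  have hinj : Function.Injective fun k : ℤ => ω + k * sectorCount n := fun a b h => by
    simpa [hN] using h
  rw [← tsum_sectorWeight n θ]
  exact tsum_comp_le_tsum_of_inj (summable_sectorWeight n θ) (fun j => (sectorWeight_mem_Icc n j θ).1) hinj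

/-- **Plateau** on the circle: if `|θ - θ_{n,ω} - 2πk| ≤ w_n/4` for some integer `k`, then
`ζ̃_{n,ω}(θ) = 1`. [cite: BenfattoGiulianiMastropietro2006, §2.5 (2.45)] -/
theorem sectorWeightCirc_eq_one {n : ℕ} {ω : ℤ} {θ : ℝ} (k : ℤ)
    (h : |θ - ((ω : ℝ) + 1 / 2) * sectorWidth n - 2 * π * k| ≤ sectorWidth n / 4) :
    sectorWeightCirc n ω θ = 1 := by
  have hw := sectorWidth_pos n
  have hwπ := sectorWidth_le_pi n
  unfold sectorWeightCirc
  rw [tsum_eq_single k]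
  · apply sectorWeight_eq_one
    rw [sectorTranslate_center]
    rwa [← sub_sub]
  · intro k' hk'
    apply sectorWeight_translate_eq_zero
    -- the other centres are at distance `≥ 2π - w/4 ≥ 3w/4`
    have h1 : (1 : ℝ) ≤ |((k' : ℝ) - k)| := by
      rw [← Int.cast_sub]; exact_mod_cast Int.one_le_abs (sub_ne_zero.2 hk')
    have h2 : |θ - ((ω : ℝ) + 1 / 2) * sectorWidth n - 2 * π * k'| ≥ 2 * π * |((k' : ℝ) - k)| - sectorWidth n / 4 := by
      have := abs_sub_abs_le_abs_sub (2 * π * ((k' : ℝ) - k)) (θ - ((ω : ℝ) + 1 / 2) * sectorWidth n - 2 * π * k)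
      rw [abs_mul, abs_of_pos two_pi_pos] at this
      rw [show θ - ((ω : ℝ) + 1 / 2) * sectorWidth n - 2 * π * k' =
        -((2 * π * ((k' : ℝ) - k)) - (θ - ((ω : ℝ) + 1 / 2) * sectorWidth n - 2 * π * k)) by ring, abs_neg]
      linarith
    nlinarith [pi_pos, hwπ, h1, h2]

/-- **Support** on the circle: if `|θ - θ_{n,ω} - 2πk| ≥ 3w_n/4` for every integer `k`, then
`ζ̃_{n,ω}(θ) = 0`. [cite: BenfattoGiulianiMastropietro2006, §2.5 (2.45)] -/
theorem sectorWeightCirc_eq_zero {n : ℕ} {ω : ℤ} {θ : ℝ}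
    (h : ∀ k : ℤ, 3 * sectorWidth n / 4 ≤ |θ - ((ω : ℝ) + 1 / 2) * sectorWidth n - 2 * π * k|) :
    sectorWeightCirc n ω θ = 0 := by
  unfold sectorWeightCirc
  exact (tsum_congr fun k => sectorWeight_translate_eq_zero (h k)).trans tsum_zero

/-- On `[0, 2π]` only the three translates `k ∈ {-1, 0, 1}` contribute. [folklore] -/
theorem sectorWeightCirc_eq_three {n : ℕ} {ω : ℕ} (hω : ω < sectorCount n) {θ : ℝ} (hθ : θ ∈ Icc (0 : ℝ) (2 * π)) :
    sectorWeightCirc n ω θ = sectorWeight n ((ω : ℤ) - sectorCount n) θ + sectorWeight n ω θ +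
      sectorWeight n ((ω : ℤ) + sectorCount n) θ := by
  unfold sectorWeightCirc
  rw [tsum_eq_sum (s := ({-1, 0, 1} : Finset ℤ))]
  · rw [Finset.sum_insert (by decide), Finset.sum_pair (by decide)]
    simp only [neg_one_mul, one_mul, zero_mul, add_zero, ← sub_eq_add_neg]
    ring
  · intro k hk
    simp only [Finset.mem_insert, Finset.mem_singleton, not_or] at hk
    apply sectorWeight_eq_zero_of_notMem_Ico hθ
    simp only [Finset.mem_Ico, not_and_or, not_le, not_lt]
    have hN : (0 : ℤ) < sectorCount n := by exact_mod_cast sectorCount_pos n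
    rcases lt_or_gt_of_ne hk.1 with h1 | h1
    · left
      have : k ≤ -2 := by omega
      nlinarith
    · right
      have : 2 ≤ k := by omega
      nlinarith

/-- **Partition of unity on the circle** (BGM (2.45), third property): `Σ_{ω<N} ζ̃_{n,ω}(θ) = 1`
for every real `θ`. [cite: BenfattoGiulianiMastropietro2006, §2.5 (2.45)] -/
theorem sum_sectorWeightCirc_eq_one (n : ℕ) (θ : ℝ) :
    ∑ ω ∈ Finset.range (sectorCount n), sectorWeightCirc n ω θ = 1 := by
  -- reduce to `θ ∈ [0, 2π)` by periodicity
  obtain ⟨m, hm⟩ := exists_angleRep_eq_add θ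
  have hθ' : angleRep θ ∈ Icc (0 : ℝ) (2 * π) := Ico_subset_Icc_self (angleRep_mem θ)
  have hper : ∀ ω : ℤ, sectorWeightCirc n ω θ = sectorWeightCirc n ω (angleRep θ) := fun ω => by
    rw [hm]
    exact ((periodic_sectorWeightCirc n ω).int_mul m θ).symm.trans (by ring_nf)
  calc ∑ ω ∈ Finset.range (sectorCount n), sectorWeightCirc n ω θ
      = ∑ ω ∈ Finset.range (sectorCount n), (sectorWeight n ((ω : ℤ) - sectorCount n) (angleRep θ) +
          sectorWeight n ω (angleRep θ) + sectorWeight n ((ω : ℤ) + sectorCount n) (angleRep θ)) := by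
        refine Finset.sum_congr rfl fun ω hω => ?_
        rw [hper, sectorWeightCirc_eq_three (Finset.mem_range.1 hω) hθ']
    _ = 1 := sum_sectorWeight_shifts_eq_one n hθ'

/-- **Derivative bounds on the circle**: `|ζ̃_{n,ω}^{(m)}(θ)| ≤ 2C_m w_n^{-m}` (locally `ζ̃` is a
sum of two translates, each obeying `abs_iteratedDeriv_sectorWeight_le`). [cite: BenfattoGiulianiMastropietro2006, §2.5 Lemma 2.2] -/
theorem abs_iteratedDeriv_sectorWeightCirc_le (m : ℕ) :
    ∃ C : ℝ, 0 ≤ C ∧ ∀ (n : ℕ) (ω : ℤ) (θ : ℝ),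
      |iteratedDeriv m (sectorWeightCirc n ω) θ| ≤ C * (sectorWidth n)⁻¹ ^ m := by
  obtain ⟨C, hC0, hC⟩ := abs_iteratedDeriv_sectorWeight_le m
  refine ⟨2 * C, by positivity, fun n ω θ₀ => ?_⟩
  have hev := (sectorWeightCirc_eventuallyEq n ω θ₀).iteratedDeriv m
  rw [hev.eq_of_nhds, iteratedDeriv_fun_sum fun k _ => (contDiff_sectorWeight n _).contDiffAt]
  set k₀ := ⌊(θ₀ - ((ω : ℝ) + 1 / 2) * sectorWidth n) / (2 * π)⌋
  by_cases hk : k₀ + 1 = k₀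
  · omega
  rw [Finset.sum_pair (Ne.symm hk)]
  calc _ ≤ |iteratedDeriv m (sectorWeight n (ω + k₀ * sectorCount n)) θ₀| +
        |iteratedDeriv m (sectorWeight n (ω + (k₀ + 1) * sectorCount n)) θ₀| := abs_add_le _ _
    _ ≤ C * (sectorWidth n)⁻¹ ^ m + C * (sectorWidth n)⁻¹ ^ m := add_le_add (hC _ _ _) (hC _ _ _)
    _ = 2 * C * (sectorWidth n)⁻¹ ^ m := by ring

end Literature.MathematicalPhysics.QuantumLattice

end
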